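import Summits.BirchSwinnertonDyer.BirchSwinnertonDyer.Theorems.PrintCFramBottomClassIndexLawFiveLeBorelGrossSurjectivityLeaf
import Summits.BirchSwinnertonDyer.BirchSwinnertonDyer.Theorems.PrintCFramBottomClassIndexLawFiveLeBorelGrossSurjectivityTower
import Summits.BirchSwinnertonDyer.BirchSwinnertonDyer.Theorems.GenusKolyvaginAtTwoGenusPrimitiveSupplyAtTwoTwistingPrimeDepthOne
import HarnessLib

/-!
# Route `PrintCFram`, crux C2 `BottomClassIndexLawFiveLe` (stmt-BirchSwinnertonDyer-20372), line
# `eisenstein-resource-bdp-line` (S2 `stub_kolyvaginUpper_borelCM_pairSum`, input (γ), the new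
# hypothesis read on points): **a Kummer class leaves the line `W[𝔭]` iff `√−p · P` is not
# `p`-divisible over the division field**
# (cell `bsd-print-cfram`, seat `bsd-line-cfram-p1-w2` g5; helper `--supports` 20372; 0 facts, 0 defs)

HONEST FRAMING. Nothing about BSD is proved here, and nothing of S2 itself. The uniserial Prop. 9.3
of the class (`exists_h1Eval_eq_of_cmRamified(_one)`, file 8c) replaced Gross's hypothesis
«`x ≠ 0`» by «some evaluation `[x, ρ]` lies off the line `W[𝔭] = ker μ`». For the Kummer class
`κ_Q = [σ ↦ σQ − Q]` of a `p`-th root `Q` of a rational point `P` this file reads that hypothesis on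
points (`[κ_Q, ρ] = ρQ − Q`, the tree's `coe_h1Eval_kummerClassTorsion`):
* §1 (any field, any curve, any additive `φ` on `E(K̄)` commuting with `Γ_{K(E[n])}`):
  `forall_apply_h1Eval_kummer_eq_zero_iff` — all `φ[κ_Q, ρ] = 0` iff `φ Q` is fixed by
  `Γ_{K(E[n])}`; `forall_smul_apply_eq_iff_exists` — iff `φ(nQ) = n R` for some `R` fixed by
  `Γ_{K(E[n])}` ("`φ P ∈ n · E(K(E[n]))`").
* §2 (the Borel CM leaf, machine currency, any level `n` with `p ∣ n`, any power `k`):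
  `torsionFixing_le_of_dvd`; `smul_sqrt_eq_of_mem_torsionFixing` — every `ρ ∈ Γ_{K''(W[n])}` fixes
  `√−p` (an element fixing `W[p]` pointwise cannot anti-commute with `μ`), so the transported
  `e μ^k e⁻¹` commutes with `Γ_{K''(W[n])}` on all of `W(K̄'')` (`apply_pow_smul_eq_of_mem_torsionFixing`);
  END STATE **`exists_h1Eval_kummer_not_mem_iff_of_cmRamified`**: for `Q ∈ W(K̄'')` with `nQ = P`
  rational, SOME evaluation of `κ_Q` lies outside `ker μ^k` **iff** `e μ^k e⁻¹ P ∉ n · W(K̄'')^{Γ_{K''(W[n])}}`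
  — for `n = p`, `k = 1` the point-theoretic form of the `r = 1` hypothesis of
  `exists_h1Eval_eq_of_cmRamified_one` / `exists_h1Eval_conj_mul_eq_zero_iff_of_cmRamified`
  (contrast Gross: `P ∉ p·E(K(E[p]))`); for `n = p^M` the top-layer conditions of file 8e.
THEOREMS ONLY; no definition, no named fact, no `sorry`. BSD is not proved by any of this; no summit
statement is proved by this seat.
References: [GrossLMS1991] §9 (the pairing `[ , ]` after Prop. 9.1, Prop. 9.3); [SilvermanAEC2009]
VIII.2 (Kummer pairing); [Rubin1999] Cor. 5.5.
-/

set_option autoImplicit false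
-- `…BirchSwinnertonDyer.BirchSwinnertonDyer.Theorems…` is the problem's mandated namespace (D-0017).
set_option linter.dupNamespace false

noncomputable section

open scoped Classical

namespace Summit.BirchSwinnertonDyer.BirchSwinnertonDyer.Theorems.PrintCFram.BorelKolyvaginPairing

open WeierstrassCurve Field Literature.NumberTheory.EllipticCurves
  Literature.NumberTheory.EllipticCurves.KolyvaginPairing Literature.NumberTheory.GaloisRepresentations
  Literature.NumberTheory.EllipticCurves.Rank1Residual
  Summit.BirchSwinnertonDyer.BirchSwinnertonDyer.Theorems.PrintCFram.BorelHomothety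
  Summit.BirchSwinnertonDyer.BirchSwinnertonDyer.Theorems.GenusKolyTwistingPrime

universe u

/-! ## §1 Kummer classes against an equivariant endomorphism (any field, any curve) -/

section Kummer

variable {K : Type u} [Field K] (V : WeierstrassCurve K) (n : ℤ)

/-- **All `φ[κ_Q, ρ] = 0` iff `φ Q` is fixed by `Γ_{K(E[n])}`**, for an additive `φ : E(K̄) → E(K̄)`
commuting with `Γ_{K(E[n])}` (`[κ_Q, ρ] = ρQ − Q`). [cite: GrossLMS1991, §9 (pairing after Prop. 9.1)] -/
theorem forall_apply_h1Eval_kummer_eq_zero_iff (φ : geomPoints V →+ geomPoints V)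
    (hφ : ∀ ρ ∈ torsionFixing V n, ∀ X : geomPoints V, φ (ρ • X) = ρ • φ X)
    (Q : geomPoints V) (hQ : n • Q ∈ MulAction.fixedPoints (absoluteGaloisGroup K) (geomPoints V)) :
    (∀ ρ ∈ torsionFixing V n,
        φ ((h1Eval V n (V.kummerClassTorsion n Q hQ) ρ : geomTorsion V n) : geomPoints V) = 0) ↔
      ∀ ρ ∈ torsionFixing V n, ρ • φ Q = φ Q := by
  refine forall₂_congr fun ρ hρ => ?_
  rw [coe_h1Eval_kummerClassTorsion V n Q hQ hρ, map_sub, hφ ρ hρ, sub_eq_zero]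

/-- **`φ Q` is fixed by `Γ_{K(E[n])}` iff `φ(nQ) ∈ n · E(K̄)^{Γ_{K(E[n])}}`** (the difference of
two `n`-th roots lies in `E[n]`, fixed by `Γ_{K(E[n])}`). [cite: SilvermanAEC2009, VIII.2 (Kummer pairing)] -/
theorem forall_smul_apply_eq_iff_exists (φ : geomPoints V →+ geomPoints V) (Q : geomPoints V) :
    (∀ ρ ∈ torsionFixing V n, ρ • φ Q = φ Q) ↔
      ∃ R : geomPoints V, (∀ ρ ∈ torsionFixing V n, ρ • R = R) ∧ φ (n • Q) = n • R := by
  constructor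
  · intro h
    exact ⟨φ Q, h, map_zsmul φ n Q⟩
  · rintro ⟨R, hR, hφ⟩ ρ hρ
    have hmem : φ Q - R ∈ geomTorsion V n := by
      rw [mem_geomTorsion_iff, smul_sub, ← map_zsmul, hφ, sub_self]
    have hfix : ρ • (φ Q - R) = φ Q - R := by
      have := (mem_torsionFixing_iff V n).mp hρ ⟨φ Q - R, hmem⟩
      exact congrArg (fun x : geomTorsion V n => (x : geomPoints V)) this
    rw [smul_sub, hR ρ hρ] at hfix
    exact sub_left_injective hfix

/-- **Kummer criterion against `φ`.** Some evaluation `φ[κ_Q, ρ]`, `ρ ∈ Γ_{K(E[n])}`, is non-zero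
iff `φ(nQ) ∉ n · E(K̄)^{Γ_{K(E[n])}}`. [cite: GrossLMS1991, §9] [cite: SilvermanAEC2009, VIII.2] -/
theorem exists_apply_h1Eval_kummer_ne_zero_iff (φ : geomPoints V →+ geomPoints V)
    (hφ : ∀ ρ ∈ torsionFixing V n, ∀ X : geomPoints V, φ (ρ • X) = ρ • φ X)
    (Q : geomPoints V) (hQ : n • Q ∈ MulAction.fixedPoints (absoluteGaloisGroup K) (geomPoints V)) :
    (∃ ρ ∈ torsionFixing V n,
        φ ((h1Eval V n (V.kummerClassTorsion n Q hQ) ρ : geomTorsion V n) : geomPoints V) ≠ 0) ↔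
      ¬ ∃ R : geomPoints V, (∀ ρ ∈ torsionFixing V n, ρ • R = R) ∧ φ (n • Q) = n • R := by
  rw [← forall_smul_apply_eq_iff_exists V n φ Q, ← forall_apply_h1Eval_kummer_eq_zero_iff V n φ hφ Q hQ]
  push Not
  rfl

end Kummer

/-! ## §2 The Borel CM leaf: `μ^k` commutes with `Γ_{K''(W[n])}`; the criterion for `ker μ^k` -/

section Leaf

variable (W : WeierstrassCurve ℚ) [W.IsElliptic] (p : ℕ) [hp : Fact p.Prime]
variable (K : Type) [Field K] [NumberField K]

omit [W.IsElliptic] hp in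
/-- `Γ_{K(E[n])} ≤ Γ_{K(E[d])}` for `d ∣ n`. [folklore] -/
theorem torsionFixing_le_of_dvd {d n : ℤ} (h : d ∣ n) :
    torsionFixing (W.baseChange K) n ≤ torsionFixing (W.baseChange K) d := fun _ hρ =>
  (mem_torsionFixing_iff _ d).mpr fun P => Subtype.ext
    (congrArg (fun x : geomTorsion (W.baseChange K) n => (x : geomPoints (W.baseChange K)))
      ((mem_torsionFixing_iff _ n).mp hρ ⟨P, (W.baseChange K).geomTorsion_le_of_dvd h P.2⟩))

/-- **Every element of `Γ_{K''(W[n])}`, `p ∣ n`, fixes `√−p`.** If `ρ` fixes `W[p]` pointwise it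
cannot negate `s = √−p`: otherwise `μ(ρP) = −ρ μ P` gives `μP = −μP`, `2μP = 0`, `μ = 0` on `W[p]`
(`p` odd), contradicting `μ ≠ 0` on `W[p]`. [cite: Rubin1999, Cor. 5.5] -/
theorem smul_sqrt_eq_of_mem_torsionFixing (h5 : 5 ≤ p)
    {s : AlgebraicClosure ℚ} {μ : AddMonoid.End W.geomPoints} {m : ℤ}
    (hs : s ^ 2 = ((-(p : ℤ) : ℤ) : AlgebraicClosure ℚ)) (hm : m.natAbs = p)
    (hμμ : ∀ P, μ (μ P) = m • P)
    (hanti : ∀ g : absoluteGaloisGroup ℚ, g • s = -s → ∀ P, μ (g • P) = -(g • μ P))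
    {n : ℤ} (hpn : (p : ℤ) ∣ n)
    {ρ : absoluteGaloisGroup K} (hρ : ρ ∈ torsionFixing (W.baseChange K) n) :
    absGaloisRestrict ℚ K ρ • s = s := by
  have hpr : p.Prime := hp.out
  have hρp : ρ ∈ torsionFixing (W.baseChange K) (p : ℤ) := torsionFixing_le_of_dvd W K hpn hρ
  have hs' : s ^ 2 = algebraMap ℚ (AlgebraicClosure ℚ) (-(p : ℚ)) := by rw [hs]; push_cast; rfl
  rcases smul_eq_or_eq_neg p ℚ hs' (absGaloisRestrict ℚ K ρ) with h | h
  · exact h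
  · exfalso
    obtain ⟨P₀, hP₀, hμP₀⟩ := exists_mem_geomTorsion_apply_ne_zero W p hμμ hm
    set θ := RatClosure.torsionEquiv (K := K) W (p : ℤ) with hθ
    -- `res ρ` fixes `W[p]` pointwise
    have hfix : ∀ t : W.geomTorsion (p : ℤ), absGaloisRestrict ℚ K ρ • (t : W.geomPoints) = t := by
      intro t
      have h1 := (mem_torsionFixing_iff (W.baseChange K) (p : ℤ)).mp hρp (θ t)
      rw [← RatClosure.torsionEquiv_smul] at h1
      exact congrArg (fun x : W.geomTorsion (p : ℤ) => (x : W.geomPoints)) (θ.injective h1)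
    have hμP₀T : μ P₀ ∈ W.geomTorsion (p : ℤ) :=
      apply_mem_torsionBy (μ : W.geomPoints →+ W.geomPoints) hP₀
    have h2 : (2 : ℤ) • μ P₀ = 0 := by
      have e1 := hanti _ h P₀
      rw [hfix ⟨P₀, hP₀⟩, hfix ⟨μ P₀, hμP₀T⟩] at e1
      rw [two_smul]
      exact add_eq_zero_iff_eq_neg.mpr e1
    -- `2` is invertible on `W[p]`
    have hcop : IsCoprime (2 : ℤ) (p : ℤ) := by
      rw [Int.isCoprime_iff_gcd_eq_one]
      have : Nat.gcd 2 p = 1 := (Nat.coprime_primes Nat.prime_two hpr).mpr (by omega)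
      exact_mod_cast this
    obtain ⟨u, v, huv⟩ := hcop
    apply hμP₀
    have hp0 : (p : ℤ) • μ P₀ = 0 := hμP₀T
    calc μ P₀ = (u * 2 + v * p) • μ P₀ := by rw [huv, one_smul]
      _ = 0 := by rw [add_smul, mul_smul, mul_smul, h2, hp0, smul_zero, smul_zero, add_zero]

omit [W.IsElliptic] hp in
/-- `μ^k` commutes with every `g` that `μ` commutes with. [folklore] -/
theorem pow_apply_smul {μ : AddMonoid.End W.geomPoints} {g : absoluteGaloisGroup ℚ}
    (hg : ∀ P, μ (g • P) = g • μ P) (k : ℕ) (P : W.geomPoints) :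
    (μ ^ k) (g • P) = g • (μ ^ k) P := by
  induction k with
  | zero => rfl
  | succ k ih => rw [pow_succ_apply, pow_succ_apply, ih, hg]

/-- **The transported `μ^k` commutes with `Γ_{K''(W[n])}` on all of `W(K̄'')`** (`p ∣ n`,
`e = RatClosure.pointsEquiv : W(ℚ̄) ≃ W(K̄'')`): `e μ^k e⁻¹ (ρX) = ρ · e μ^k e⁻¹ X`.
[cite: Rubin1999, Cor. 5.5] -/
theorem apply_pow_smul_eq_of_mem_torsionFixing (h5 : 5 ≤ p)
    {s : AlgebraicClosure ℚ} {μ : AddMonoid.End W.geomPoints} {m : ℤ}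
    (hs : s ^ 2 = ((-(p : ℤ) : ℤ) : AlgebraicClosure ℚ)) (hm : m.natAbs = p)
    (hμμ : ∀ P, μ (μ P) = m • P)
    (hcomm : ∀ g : absoluteGaloisGroup ℚ, g • s = s → ∀ P, μ (g • P) = g • μ P)
    (hanti : ∀ g : absoluteGaloisGroup ℚ, g • s = -s → ∀ P, μ (g • P) = -(g • μ P))
    {n : ℤ} (hpn : (p : ℤ) ∣ n) (k : ℕ)
    {ρ : absoluteGaloisGroup K} (hρ : ρ ∈ torsionFixing (W.baseChange K) n)
    (X : geomPoints (W.baseChange K)) :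
    RatClosure.pointsEquiv (K := K) W ((μ ^ k) ((RatClosure.pointsEquiv (K := K) W).symm (ρ • X))) =
      ρ • RatClosure.pointsEquiv (K := K) W ((μ ^ k) ((RatClosure.pointsEquiv (K := K) W).symm X)) := by
  set e := RatClosure.pointsEquiv (K := K) W with he
  have hfix := smul_sqrt_eq_of_mem_torsionFixing W p K h5 hs hm hμμ hanti hpn hρ
  obtain ⟨Y, rfl⟩ := e.surjective X
  rw [← RatClosure.pointsEquiv_smul, e.symm_apply_apply, e.symm_apply_apply,
    pow_apply_smul W (hcomm _ hfix) k, RatClosure.pointsEquiv_smul]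

/-- **END STATE: a Kummer class has a value outside `ker μ^k` iff `μ^k P ∉ n·W(K̄'')^{Γ_{K''(W[n])}}`.**
`W/ℚ` CM, `p ≥ 5` CM-ramified, `μ = √−p` with its sign rule (`exists_sqrt_end_of_cmRamified`), `K''`
any number field, `p ∣ n`, `e = RatClosure.pointsEquiv`, `θ = RatClosure.torsionEquiv W n`. For
`Q ∈ W(K̄'')` with `nQ = P` rational and any `k`: the Kummer class `κ_Q ∈ H¹(K'', W[n])` has SOME
evaluation outside `ker μ^k` — `μ^k(θ⁻¹[κ_Q, ρ₀]) ≠ 0`, the shape of the hypotheses of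
`exists_h1Eval_eq_of_cmRamified_one` (`n = p`, `k = 1`: off the line `W[𝔭]`) and of the top layers of
`exists_h1Eval_eq_pow_of_cmRamified` — iff `e μ^k e⁻¹ P` is NOT `n` times a point fixed by
`Γ_{K''(W[n])}`. (Gross's hypothesis at a surjective prime reads `P ∉ p·E(K(E[p]))`; at the Borel
prime, `n = p`, `k = 1`, it is `√−p·P ∉ p·W(L)`, `L = K''(W[p]) ∋ √−p`, i.e. `P ∉ √−p·W(L) + W[𝔭]`.)
[cite: GrossLMS1991, §9 Prop. 9.3] [cite: SilvermanAEC2009, VIII.2] [cite: Rubin1999, Cor. 5.5] -/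
theorem exists_h1Eval_kummer_not_mem_iff_of_cmRamified (h5 : 5 ≤ p)
    {s : AlgebraicClosure ℚ} {μ : AddMonoid.End W.geomPoints} {m : ℤ}
    (hs : s ^ 2 = ((-(p : ℤ) : ℤ) : AlgebraicClosure ℚ)) (hm : m.natAbs = p)
    (hμμ : ∀ P, μ (μ P) = m • P)
    (hcomm : ∀ g : absoluteGaloisGroup ℚ, g • s = s → ∀ P, μ (g • P) = g • μ P)
    (hanti : ∀ g : absoluteGaloisGroup ℚ, g • s = -s → ∀ P, μ (g • P) = -(g • μ P))
    {n : ℤ} (hpn : (p : ℤ) ∣ n) (k : ℕ) (Q : geomPoints (W.baseChange K))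
    (hQ : n • Q ∈ MulAction.fixedPoints (absoluteGaloisGroup K) (geomPoints (W.baseChange K))) :
    (∃ ρ ∈ torsionFixing (W.baseChange K) n,
        (μ ^ k) ((RatClosure.torsionEquiv (K := K) W n).symm
          (h1Eval (W.baseChange K) n ((W.baseChange K).kummerClassTorsion n Q hQ) ρ) :
            W.geomTorsion n) ≠ 0) ↔
      ¬ ∃ R : geomPoints (W.baseChange K), (∀ ρ ∈ torsionFixing (W.baseChange K) n, ρ • R = R) ∧
        RatClosure.pointsEquiv (K := K) W ((μ ^ k) ((RatClosure.pointsEquiv (K := K) W).symm (n • Q))) =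
          n • R := by
  set e := RatClosure.pointsEquiv (K := K) W with he
  -- the transported endomorphism `e ∘ μ^k ∘ e⁻¹`
  set φ : geomPoints (W.baseChange K) →+ geomPoints (W.baseChange K) :=
    e.toAddMonoidHom.comp (((μ ^ k : AddMonoid.End W.geomPoints) : W.geomPoints →+ W.geomPoints).comp
      e.symm.toAddMonoidHom) with hφ
  have hφapp : ∀ X, φ X = e ((μ ^ k) (e.symm X)) := fun _ => rfl
  have hφG : ∀ ρ ∈ torsionFixing (W.baseChange K) n, ∀ X, φ (ρ • X) = ρ • φ X :=
    fun ρ hρ X => by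
      rw [hφapp, hφapp]
      exact apply_pow_smul_eq_of_mem_torsionFixing W p K h5 hs hm hμμ hcomm hanti hpn k hρ X
  have key := exists_apply_h1Eval_kummer_ne_zero_iff (W.baseChange K) n φ hφG Q hQ
  -- the `θ⁻¹`-form of the condition is the `φ`-form
  have hiff : ∀ t : geomTorsion (W.baseChange K) n,
      (μ ^ k) ((RatClosure.torsionEquiv (K := K) W n).symm t : W.geomTorsion n) ≠ 0 ↔
        φ (t : geomPoints (W.baseChange K)) ≠ 0 := by
    intro t
    rw [hφapp, ne_eq, ne_eq, e.map_eq_zero_iff]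
    rfl
  simp only [hiff]
  rw [key]
  exact Iff.rfl

end Leaf

end Summit.BirchSwinnertonDyer.BirchSwinnertonDyer.Theorems.PrintCFram.BorelKolyvaginPairing

end
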